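import Summits.QuantumFields.YangMills.Theorems.BalabanUVNodesN19TiltPathEndpoints

/-!
# BalabanUVNodes ∕ N19 — THE ANNEALED (TILT-PATH) ROAD, III: CLASS LEVEL — MASS_cl FROM THE DRIFT, TV_cl FROM THE OSCILLATION, HENCE THE
# OBSERVABLE-UNIFORM `Spine.NE7.Core` (16b) AND N14's BINDER, FROM FIRST-MOMENT ∕ L¹ DATA OF ONE TILT PATH PER CLASS

Cell `pub-ymgap` (HUMAN RULING D-0062, Track A), node N19 = NE7, R134 seat `pub-ymgap-dag-n19-c` (g9); third of three modules of bus INTENT-17 (l.17277;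
dag-lead DEDUP l.17308 GO; LENS control g8 GO-17 l.17321, note (e) folded in the wording below).  Filed `--kind proof --supports` K3⁗ `SpineGivenEndpointR13Sep`
= stmt-QuantumFields-20292 `--as helper`.  COUNT-NEUTRAL.  THEOREMS ONLY (0 `def`); imports module II `…N19TiltPathEndpoints` (hence module I and 16a∕16b);
edits nothing.

SETTING (16b's: road (iii)).  Two runs' class pieces `μA K τ`, `μB K τ` on the SAME class spaces `Ω K`, ONE `B`-bounded observable family `W K`, dressed
class terms in MGF form.  NEW DATUM: class by class a TILT PATH `u ↦ e^{Ψ K τ u}·μA K τ` from run A's piece (`Ψ K τ 0 = 0`) to run B's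
(`μB K τ = e^{Ψ K τ 1}·μA K τ`) — exponent measurable, pointwise C¹ in `u`, locally uniformly bounded — with, on the (t-uniformly) good non-null classes,
(DRIFT) the tilted mean of the direction `Ψ′ K τ u` within `r₁ K` of ONE CLASS-FREE drift `k′_K(u)` on `[0,1]`, and (OSC) its L¹-oscillation `≤ 2ρ K`.
WHERE SUCH A PATH CAN LIVE (LENS control GO-17 (e), memo v6.0 §B (B1)∕(B2), row s18): as a CLASS-SPACE chord (`Ω K` = the common class space, e.g. the
unit lattice via p496221 `classSandwich_map` ∕ 16b `tvSandwich_map`, `Ψ_1` the class-level log-density — there the straight chord's data are SHAPE-type and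
implied by DENS ∕ SHAPE, module I `drift_osc_of_pointwise`), or as a TUNED fine-space path (LENS control CARD 11: countertermed so that the interpolated laws
stay on a line of constant physics) — NEVER as the fine-space STRAIGHT chord through run `K+1`'s one-step log-density, whose pointwise-in-`u` data carry a
K-independent floor at the record (the lens's located obstruction N1; only the `u`-INTEGRALS — MASS_cl ∕ TV_cl themselves — are small there).  The theorems
below keep `Ψ` GENERAL accordingly.

WHAT IS PROVED ([folklore] ∘ modules I–II + 16b BY NAME).
* `integrable_exp_of_bounds` · ★ `massSandwich_of_tiltPath` (DRIFT ⇒ MASS_cl(r₁) in p496221's `ℝ≥0∞` letters, constant `c_K = k_K 1 − k_K 0`; null classes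
  carry null pieces) · ★ `tvSandwich_of_tiltPath` (OSC ⇒ TV_cl(ρ) in 16b's letters, via module I's dictionary `tilted_real_eq_div` ∕ `tilted_zero_real_eq_div`) ·
  ★★ `core_of_tiltPath` (DRIFT ∧ OSC ∧ `r₁ K + (e^{2l₀B} − 1)·ρ K ≤ vol·δ K` ⇒ `Core l₀ vol T Bad P Q δ` for EVERY `B`-bounded MGF-form observable family —
  ONE application of 16b `core_of_mass_of_tv`) · ★ `tiltedMeanMatching_of_tiltPath` (OSC alone ⇒ road (ii)'s `TiltedMeanMatching … (K ↦ 4B·e^{2l₀B}·ρ_K)`,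
  N14's binder, via 16b `tiltedMeanMatching_of_tv` — the class-indexed, mass-aware, all-observables sibling of file P's one-observable
  `tiltedMeanMatching_of_lawChannel`).
READING (beside 16b's chain).  DENS_cl⁰ ⟹ NE7-S_cl ⟹ (straight chord) DRIFT ∧ OSC ⟹ MASS_cl ∧ TV_cl ⟺ {`Core` ∀ bounded `W`}; the annealed data are
what an interpolation ∕ Feynman–Hellmann argument along a tuned path would naturally deliver (first and centred-first moments of the direction), the
pointwise sandwich being the degenerate case.

HONEST FRAMING.  [folklore] measure arithmetic on hypothesis SHAPES; SUPPORT-MATCHED case only (tilt paths force `μA K τ ~ μB K τ`); every path datum is a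
HYPOTHESIS (NODE O ∕ U3 objects and estimates, produced by nobody); NE7 ∕ NE1′ NOT PRINTED as two-run statements for d = 4 and NOT proved; N19 NOT
discharged (0∕1); N14 NOT discharged; K3⁗ NOT claimed; counts UNMOVED (typed 28∕28 · discharged 5∕27 · A 5∕28); one finite four-torus programme at fixed
`ε` — NOT ℝ⁴, NOT OS, NOT a mass gap, NOT Clay.  0 `def`; 0 `sorry`; standard axioms.
-/

set_option autoImplicit false

noncomputable section

open MeasureTheory ProbabilityTheory Set Filter Topology
open scoped ENNReal

namespace Summit.QuantumFields.YangMills.BalabanUVNodes.N19TiltPathRoad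

open Summit.QuantumFields.BalabanUV.T4Continuum.NE1p.DressedMGFForm (tiltedMean MGFForm TiltedMeanMatching)
open Summit.QuantumFields.BalabanUV.T4Continuum.Spine.NE7 (Core)
open Summit.QuantumFields.YangMills.BalabanUVNodes.N19TiltPathCalculus
open Summit.QuantumFields.YangMills.BalabanUVNodes.N19TiltPathEndpoints
open Summit.QuantumFields.YangMills.BalabanUVNodes.N19CoreTVInvariant (core_of_mass_of_tv tiltedMeanMatching_of_tv)
open Summit.QuantumFields.YangMills.BalabanUVNodes.N19TVCurrency (ennreal_sandwich_of_real)

variable {ι : Type*} [DecidableEq ι] {Ω : ℕ → Type*} [∀ K, MeasurableSpace (Ω K)]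
  {l₀ vol B : ℝ} {T : ℕ → Finset ι} {Bad : ℕ → ℝ → Finset ι} {W : ∀ K, Ω K → ℝ}
  {μA μB : ∀ K, ι → Measure (Ω K)} {P Q : ℕ → ℝ → ι → ℝ} {δ r₁ ρ : ℕ → ℝ}
  {Ψ Ψ' : ∀ K, ι → ℝ → Ω K → ℝ} {k k' : ℕ → ℝ → ℝ}

/-! ## §1 Integrability of the path's pieces -/

/-- Integrability of `e^{ψ_u}` against a finite class piece (locally bounded exponent). [folklore] -/
theorem integrable_exp_of_bounds {X : Type*} [MeasurableSpace X] {μ : Measure X} [IsFiniteMeasure μ] {ψ ψ' : ℝ → X → ℝ}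
    (hψm : ∀ u, Measurable (ψ u))
    (hbd : ∀ u₀ : ℝ, ∃ ε > 0, ∃ M : ℝ, ∀ u ∈ Metric.ball u₀ ε, ∀ x, |ψ u x| ≤ M ∧ |ψ' u x| ≤ M) (u : ℝ) :
    Integrable (fun x => Real.exp (ψ u x)) μ := by
  obtain ⟨ε, hε, M, hM⟩ := hbd u
  exact integrable_of_abs_le (Real.measurable_exp.comp (hψm u)) fun x => by
    rw [Real.abs_exp]; exact Real.exp_le_exp.2 ((le_abs_self _).trans (hM u (Metric.mem_ball_self hε) x).1)

/-! ## §2 MASS_cl from the drift, TV_cl from the oscillation (16b's letters) -/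

/-- ★ **MASS_cl FROM THE DRIFT.**  Two runs' class pieces joined, class by class, by a tilt path `u ↦ e^{Ψ K τ u}·μA K τ` (`Ψ K τ 0 = 0`,
run B's piece `μB K τ = e^{Ψ K τ 1}·μA K τ`; exponent measurable, pointwise C¹ in `u`, locally uniformly bounded); if on every (t-uniformly) good,
non-null class the tilted mean of the path direction stays within `r₁ K` of ONE CLASS-FREE drift `k′_K(u)` on `[0,1]`, then MASS_cl(r₁) holds in
p496221's `ℝ≥0∞` letters with the constant `c_K = k_K 1 − k_K 0`. [folklore ∘ `N19TiltPathCalculus.mass_sandwich_of_pathDrift`] -/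
theorem massSandwich_of_tiltPath (hfin : ∀ K, ∀ τ ∈ T K, IsFiniteMeasure (μA K τ))
    (hΨm : ∀ K τ u, Measurable (Ψ K τ u)) (hΨ'm : ∀ K τ u, Measurable (Ψ' K τ u))
    (hΨd : ∀ K τ u x, HasDerivAt (fun v => Ψ K τ v x) (Ψ' K τ u x) u)
    (hbd : ∀ K τ (u₀ : ℝ), ∃ ε > 0, ∃ M : ℝ, ∀ u ∈ Metric.ball u₀ ε, ∀ x, |Ψ K τ u x| ≤ M ∧ |Ψ' K τ u x| ≤ M)
    (hΨ0 : ∀ K τ x, Ψ K τ 0 x = 0)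
    (hB : ∀ K, ∀ τ ∈ T K, μB K τ = (μA K τ).withDensity fun x => ENNReal.ofReal (Real.exp (Ψ K τ 1 x)))
    (hk : ∀ K, ∀ u ∈ Icc (0 : ℝ) 1, HasDerivWithinAt (k K) (k' K u) (Icc (0 : ℝ) 1) u)
    (hdrift : ∀ (K : ℕ) (t : ℝ), |t| ≤ l₀ → ∀ τ ∈ T K \ Bad K t, μA K τ ≠ 0 → ∀ u ∈ Icc (0 : ℝ) 1,
      |∫ x, Ψ' K τ u x ∂((μA K τ).tilted (Ψ K τ u)) - k' K u| ≤ r₁ K) :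
    ∀ K : ℕ, ∃ c : ℝ, ∀ t : ℝ, |t| ≤ l₀ → ∀ τ ∈ T K \ Bad K t,
      ENNReal.ofReal (Real.exp (c - r₁ K)) * μA K τ Set.univ ≤ μB K τ Set.univ ∧
        μB K τ Set.univ ≤ ENNReal.ofReal (Real.exp (c + r₁ K)) * μA K τ Set.univ := by
  intro K
  refine ⟨k K 1 - k K 0, fun t ht τ hτ => ?_⟩
  have hτT : τ ∈ T K := (Finset.mem_sdiff.mp hτ).1
  haveI := hfin K τ hτT
  rcases eq_or_ne (μA K τ) 0 with h0 | h0
  · -- a null class: both pieces vanish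
    have hB0 : μB K τ Set.univ = 0 := by
      rw [hB K τ hτT, withDensity_apply _ MeasurableSet.univ, Measure.restrict_univ, h0, lintegral_zero_measure]
    rw [hB0, h0]
    simp
  haveI : NeZero (μA K τ) := ⟨h0⟩
  have hexp1 : Integrable (fun x => Real.exp (Ψ K τ 1 x)) (μA K τ) := integrable_exp_of_bounds (hΨm K τ) (hbd K τ) 1
  have hsand := mass_sandwich_of_pathDrift (μ := μA K τ) (hΨm K τ) (hΨ'm K τ) (hΨd K τ) (hbd K τ) (hk K)
    (hdrift K t ht τ hτ h0)
  -- the two ends: `∫ e^{Ψ 0} = μA(univ)` and `∫ e^{Ψ 1} = μB(univ)`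
  have hZ0 : ∫ x, Real.exp (Ψ K τ 0 x) ∂(μA K τ) = (μA K τ).real Set.univ := by
    simp only [hΨ0, Real.exp_zero, integral_const, smul_eq_mul, mul_one]
  have hZ1 : ∫ x, Real.exp (Ψ K τ 1 x) ∂(μA K τ) = (μB K τ).real Set.univ := by
    rw [hB K τ hτT, withDensity_exp_real hexp1 MeasurableSet.univ, setIntegral_univ]
  rw [hZ0, hZ1] at hsand
  haveI : IsFiniteMeasure (μB K τ) := by
    rw [hB K τ hτT]; exact isFiniteMeasure_withDensity_ofReal hexp1.2
  exact ennreal_sandwich_of_real (μ := μA K τ) (ν := μB K τ) (Real.exp_pos _).le (Real.exp_pos _).le hsand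

/-- ★ **TV_cl FROM THE OSCILLATION.**  Same path data; if on every good non-null class the L¹-oscillation of the path direction under the
interpolating law `μ̂_{K,τ,u}` is `≤ 2ρ K` on `[0,1]` (`0 ≤ ρ`), then TV_cl(ρ) holds in 16b's letters: the NORMALISED class laws of the two runs are
`ρ K`-close on every measurable set. [folklore ∘ `N19TiltPathCalculus.abs_tilted_real_sub_le_of_pathOsc` + the dictionary] -/
theorem tvSandwich_of_tiltPath (hfin : ∀ K, ∀ τ ∈ T K, IsFiniteMeasure (μA K τ))
    (hΨm : ∀ K τ u, Measurable (Ψ K τ u)) (hΨ'm : ∀ K τ u, Measurable (Ψ' K τ u))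
    (hΨd : ∀ K τ u x, HasDerivAt (fun v => Ψ K τ v x) (Ψ' K τ u x) u)
    (hbd : ∀ K τ (u₀ : ℝ), ∃ ε > 0, ∃ M : ℝ, ∀ u ∈ Metric.ball u₀ ε, ∀ x, |Ψ K τ u x| ≤ M ∧ |Ψ' K τ u x| ≤ M)
    (hΨ0 : ∀ K τ x, Ψ K τ 0 x = 0)
    (hB : ∀ K, ∀ τ ∈ T K, μB K τ = (μA K τ).withDensity fun x => ENNReal.ofReal (Real.exp (Ψ K τ 1 x))) (hρ : ∀ K, 0 ≤ ρ K)
    (hosc : ∀ (K : ℕ) (t : ℝ), |t| ≤ l₀ → ∀ τ ∈ T K \ Bad K t, μA K τ ≠ 0 → ∀ u ∈ Icc (0 : ℝ) 1,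
      ∫ x, |Ψ' K τ u x - ∫ y, Ψ' K τ u y ∂((μA K τ).tilted (Ψ K τ u))| ∂((μA K τ).tilted (Ψ K τ u)) ≤ 2 * ρ K) :
    ∀ (K : ℕ) (t : ℝ), |t| ≤ l₀ → ∀ τ ∈ T K \ Bad K t, ∀ S : Set (Ω K), MeasurableSet S →
      |(μB K τ).real S / (μB K τ).real Set.univ - (μA K τ).real S / (μA K τ).real Set.univ| ≤ ρ K := by
  intro K t ht τ hτ S hS
  have hτT : τ ∈ T K := (Finset.mem_sdiff.mp hτ).1
  haveI := hfin K τ hτT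
  rcases eq_or_ne (μA K τ) 0 with h0 | h0
  · have hB0 : μB K τ = 0 := by rw [hB K τ hτT, h0, withDensity_zero_left]
    rw [hB0, h0]
    simpa using hρ K
  haveI : NeZero (μA K τ) := ⟨h0⟩
  have hexp1 : Integrable (fun x => Real.exp (Ψ K τ 1 x)) (μA K τ) := integrable_exp_of_bounds (hΨm K τ) (hbd K τ) 1
  have h1 : (μB K τ).real S / (μB K τ).real Set.univ = ((μA K τ).tilted (Ψ K τ 1)).real S := by
    rw [hB K τ hτT, tilted_real_eq_div hexp1 hS]
  have hΨ00 : Ψ K τ 0 = 0 := funext (hΨ0 K τ)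
  have h0' : (μA K τ).real S / (μA K τ).real Set.univ = ((μA K τ).tilted (Ψ K τ 0)).real S := by
    rw [hΨ00, tilted_zero_real_eq_div]
  rw [h1, h0']
  exact abs_tilted_real_sub_le_of_pathOsc (hΨm K τ) (hΨ'm K τ) (hΨd K τ) (hbd K τ) (hosc K t ht τ hτ h0) hS

/-! ## §3 The annealed road to the observable-uniform `Spine.NE7.Core` and to N14's binder -/

/-- ★★ **THE ANNEALED (TILT-PATH) ROAD TO `Spine.NE7.Core`.**  Two runs' class terms in MGF form for the SAME `B`-bounded observable family on the
SAME class spaces; class by class a tilt path from run A's piece to run B's (`μB = e^{Ψ_1}·μA`); on the good non-null classes the path direction has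
(i) tilted MEAN within `r₁ K` of one class-free drift `k′_K` and (ii) L¹-OSCILLATION `≤ 2ρ K`; and the width budget `r₁ K + (e^{2l₀B} − 1)·ρ K ≤ vol·δ K`.
Then `Core l₀ vol T Bad P Q δ` — for EVERY such observable family, ONE constant `c_K = k_K 1 − k_K 0`, at every `t` of the window.
FIRST-MOMENT ∕ L¹ data replace the POINTWISE log-density sandwich of the DENS ∕ SHAPE roads (which imply them on the straight chord,
`N19TiltPathCalculus.drift_osc_of_pointwise`).  [folklore ∘ §2 + 16b `core_of_mass_of_tv`] -/
theorem core_of_tiltPath (hP : MGFForm B T W μA P) (hQ : MGFForm B T W μB Q)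
    (hΨm : ∀ K τ u, Measurable (Ψ K τ u)) (hΨ'm : ∀ K τ u, Measurable (Ψ' K τ u))
    (hΨd : ∀ K τ u x, HasDerivAt (fun v => Ψ K τ v x) (Ψ' K τ u x) u)
    (hbd : ∀ K τ (u₀ : ℝ), ∃ ε > 0, ∃ M : ℝ, ∀ u ∈ Metric.ball u₀ ε, ∀ x, |Ψ K τ u x| ≤ M ∧ |Ψ' K τ u x| ≤ M)
    (hΨ0 : ∀ K τ x, Ψ K τ 0 x = 0)
    (hB : ∀ K, ∀ τ ∈ T K, μB K τ = (μA K τ).withDensity fun x => ENNReal.ofReal (Real.exp (Ψ K τ 1 x))) (hρ : ∀ K, 0 ≤ ρ K)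
    (hk : ∀ K, ∀ u ∈ Icc (0 : ℝ) 1, HasDerivWithinAt (k K) (k' K u) (Icc (0 : ℝ) 1) u)
    (hdrift : ∀ (K : ℕ) (t : ℝ), |t| ≤ l₀ → ∀ τ ∈ T K \ Bad K t, μA K τ ≠ 0 → ∀ u ∈ Icc (0 : ℝ) 1,
      |∫ x, Ψ' K τ u x ∂((μA K τ).tilted (Ψ K τ u)) - k' K u| ≤ r₁ K)
    (hosc : ∀ (K : ℕ) (t : ℝ), |t| ≤ l₀ → ∀ τ ∈ T K \ Bad K t, μA K τ ≠ 0 → ∀ u ∈ Icc (0 : ℝ) 1,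
      ∫ x, |Ψ' K τ u x - ∫ y, Ψ' K τ u y ∂((μA K τ).tilted (Ψ K τ u))| ∂((μA K τ).tilted (Ψ K τ u)) ≤ 2 * ρ K)
    (hw : ∀ K, r₁ K + (Real.exp (2 * (l₀ * B)) - 1) * ρ K ≤ vol * δ K) :
    Core l₀ vol T Bad P Q δ :=
  core_of_mass_of_tv hP hQ (massSandwich_of_tiltPath hP.finite hΨm hΨ'm hΨd hbd hΨ0 hB hk hdrift)
    (tvSandwich_of_tiltPath hP.finite hΨm hΨ'm hΨd hbd hΨ0 hB hρ hosc) hw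

/-- ★ **… AND TO N14's BINDER**: the oscillation datum alone gives road (ii)'s `TiltedMeanMatching l₀ T Bad W μA W μB (K ↦ 4B·e^{2l₀B}·ρ_K)` for
every `B`-bounded measurable observable family — 16b `tiltedMeanMatching_of_tv` ∘ §2.  (At the law level this is the class-indexed, mass-aware sibling
of n14-c's file P `tiltedMeanMatching_of_lawChannel`: there ONE observable, normalised laws, covariance bound; here every bounded observable at once
through TV.) [folklore] -/
theorem tiltedMeanMatching_of_tiltPath (hfin : ∀ K, ∀ τ ∈ T K, IsFiniteMeasure (μA K τ)) (hB0 : 0 ≤ B)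
    (hWm : ∀ K, Measurable (W K)) (hWb : ∀ K ω, |W K ω| ≤ B)
    (hΨm : ∀ K τ u, Measurable (Ψ K τ u)) (hΨ'm : ∀ K τ u, Measurable (Ψ' K τ u))
    (hΨd : ∀ K τ u x, HasDerivAt (fun v => Ψ K τ v x) (Ψ' K τ u x) u)
    (hbd : ∀ K τ (u₀ : ℝ), ∃ ε > 0, ∃ M : ℝ, ∀ u ∈ Metric.ball u₀ ε, ∀ x, |Ψ K τ u x| ≤ M ∧ |Ψ' K τ u x| ≤ M)
    (hΨ0 : ∀ K τ x, Ψ K τ 0 x = 0)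
    (hB : ∀ K, ∀ τ ∈ T K, μB K τ = (μA K τ).withDensity fun x => ENNReal.ofReal (Real.exp (Ψ K τ 1 x))) (hρ : ∀ K, 0 ≤ ρ K)
    (hosc : ∀ (K : ℕ) (t : ℝ), |t| ≤ l₀ → ∀ τ ∈ T K \ Bad K t, μA K τ ≠ 0 → ∀ u ∈ Icc (0 : ℝ) 1,
      ∫ x, |Ψ' K τ u x - ∫ y, Ψ' K τ u y ∂((μA K τ).tilted (Ψ K τ u))| ∂((μA K τ).tilted (Ψ K τ u)) ≤ 2 * ρ K) :
    TiltedMeanMatching l₀ T Bad W μA W μB fun K => 4 * B * Real.exp (2 * (l₀ * B)) * ρ K := by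
  have hfinB : ∀ K, ∀ τ ∈ T K, IsFiniteMeasure (μB K τ) := fun K τ hτ => by
    haveI := hfin K τ hτ
    rw [hB K τ hτ]
    exact isFiniteMeasure_withDensity_ofReal (integrable_exp_of_bounds (hΨm K τ) (hbd K τ) 1).2
  exact tiltedMeanMatching_of_tv hfin hfinB hB0 hWm hWb (tvSandwich_of_tiltPath hfin hΨm hΨ'm hΨd hbd hΨ0 hB hρ hosc)

end Summit.QuantumFields.YangMills.BalabanUVNodes.N19TiltPathRoad

end
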